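import Summits.AtomisticToContinuum.Crystallization.Theorems.PalmUnimodularRigidityShellsToBarlowChartTransportOpsDefs

/-!
# Line `develop-the-model-growth-descent` (crux `ShellsToBarlowChart`, stmt-AtomisticToContinuum-9227): pattern facts, part 1

Decidable facts about the two integer kissing patterns `fcc3Int`, `hcpInt` (labels at squared
norm `18`) used by the frame transports of `stub_transportSystem`: hexagons, even/odd caps,
their filters, apexes, distance tables, lower caps and the letters read on them.  Every fact was
first verified by brute force (work/sim/facts.py of the lead's folder) and is proved here by
`decide` (split into small files so that each elaborates quickly).  All `[folklore]`
(finite checks on the cuboctahedron / anticuboctahedron, HalesDSP2012 §1.3).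
-/

namespace Summit.AtomisticToContinuum.Crystallization.Theorems.PalmUnimodularRigidityShellsToBarlowChart

open Literature.Geometry.DiscreteGeometry

/-- FCC labels are centrally symmetric. [folklore] -/
theorem neg_mem_fcc3Int : ∀ a ∈ fcc3Int, -a ∈ fcc3Int := by
  decide

/-- Two touching labels whose opposites are labels span a full hexagon of the pattern (FCC: always; HCP: two equatorial labels). [folklore] -/
theorem hexLabels_subset_of_symm : ∀ P : Finset (Fin 3 → ℤ), (P = fcc3Int ∨ P = hcpInt) →
    ∀ a ∈ P, ∀ b ∈ P, sqNormInt (a - b) = 18 → -a ∈ P → -b ∈ P → hexLabels a b ⊆ P := by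
  rintro P (rfl | rfl) <;> decide

/-- **The workhorse identity.** If `ξ ~ η`, `θ ~ η`, `D(θ, ξ) = 54` and `η − ξ` is a label, then `θ = η − ξ` (the hexagon vertex after `η` away from `ξ`). [folklore] -/
theorem label_third_vertex : ∀ P : Finset (Fin 3 → ℤ), (P = fcc3Int ∨ P = hcpInt) →
    ∀ ξ ∈ P, ∀ η ∈ P, ∀ θ ∈ P, sqNormInt (ξ - η) = 18 → sqNormInt (θ - η) = 18 → sqNormInt (θ - ξ) = 54 → η - ξ ∈ P → θ = η - ξ := by
  rintro P (rfl | rfl) <;> decide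

/-- A label `c` off the hexagon with `c − a, c − b` labels gives the even cap `{c, c−a, c−b}`: a valid frame of parity `+1`. [folklore] -/
theorem isFrame_evenCap : ∀ P : Finset (Fin 3 → ℤ), (P = fcc3Int ∨ P = hcpInt) →
    ∀ a ∈ P, ∀ b ∈ P, ∀ c ∈ P, sqNormInt (a - b) = 18 → hexLabels a b ⊆ P → c ∉ hexLabels a b → c - a ∈ P → c - b ∈ P → IsFrame P a b ({c, c - a, c - b} : Finset (Fin 3 → ℤ)) ∧ frameParity a b ({c, c - a, c - b} : Finset (Fin 3 → ℤ)) = 1 := by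
  rintro P (rfl | rfl) <;> decide

/-- The even cap is the cap of each of its elements. [folklore] -/
theorem capWithAny_evenCap : ∀ P : Finset (Fin 3 → ℤ), (P = fcc3Int ∨ P = hcpInt) →
    ∀ a ∈ P, ∀ b ∈ P, ∀ c ∈ P, ∀ m ∈ P, sqNormInt (a - b) = 18 → hexLabels a b ⊆ P → c ∉ hexLabels a b → c - a ∈ P → c - b ∈ P → m ∈ ({c, c - a, c - b} : Finset (Fin 3 → ℤ)) → capWithAny P a b {m} = ({c, c - a, c - b} : Finset (Fin 3 → ℤ)) := by
  rintro P (rfl | rfl) <;> decide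

/-- The even cap is `capWith` of its apex. [folklore] -/
theorem capWith_evenCap : ∀ P : Finset (Fin 3 → ℤ), (P = fcc3Int ∨ P = hcpInt) →
    ∀ a ∈ P, ∀ b ∈ P, ∀ c ∈ P, sqNormInt (a - b) = 18 → hexLabels a b ⊆ P → c ∉ hexLabels a b → c - a ∈ P → c - b ∈ P → capWith P a b c = ({c, c - a, c - b} : Finset (Fin 3 → ℤ)) := by
  rintro P (rfl | rfl) <;> decide

/-- In the even cap, the element touching `a` (resp. `b`, `−a`, `−b`) is `c` (resp. `c`, `c − a`, `c − b`). [folklore] -/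
theorem filter_evenCap : ∀ P : Finset (Fin 3 → ℤ), (P = fcc3Int ∨ P = hcpInt) →
    ∀ a ∈ P, ∀ b ∈ P, ∀ c ∈ P, sqNormInt (a - b) = 18 → hexLabels a b ⊆ P → c ∉ hexLabels a b → c - a ∈ P → c - b ∈ P → ({c, c - a, c - b} : Finset (Fin 3 → ℤ)).filter (fun e => sqNormInt (e - a) = 18) = {c} ∧ ({c, c - a, c - b} : Finset (Fin 3 → ℤ)).filter (fun e => sqNormInt (e - b) = 18) = {c} ∧ ({c, c - a, c - b} : Finset (Fin 3 → ℤ)).filter (fun e => sqNormInt (e + a) = 18) = {c - a} ∧ ({c, c - a, c - b} : Finset (Fin 3 → ℤ)).filter (fun e => sqNormInt (e + b) = 18) = {c - b} := by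
  rintro P (rfl | rfl) <;> decide

/-- In the even cap the apex is `c`. [folklore] -/
theorem apex_evenCap : ∀ P : Finset (Fin 3 → ℤ), (P = fcc3Int ∨ P = hcpInt) →
    ∀ a ∈ P, ∀ b ∈ P, ∀ c ∈ P, sqNormInt (a - b) = 18 → hexLabels a b ⊆ P → c ∉ hexLabels a b → c - a ∈ P → c - b ∈ P → ∀ e ∈ ({c, c - a, c - b} : Finset (Fin 3 → ℤ)), ((e - a ∈ ({c, c - a, c - b} : Finset (Fin 3 → ℤ)) ∧ e - b ∈ ({c, c - a, c - b} : Finset (Fin 3 → ℤ))) ∨ (e + a ∈ ({c, c - a, c - b} : Finset (Fin 3 → ℤ)) ∧ e + b ∈ ({c, c - a, c - b} : Finset (Fin 3 → ℤ)))) → e = c := by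
  rintro P (rfl | rfl) <;> decide

/-- Even cap: the table of squared distances to the hexagon used by the transports. [folklore] -/
theorem dist_evenCap : ∀ P : Finset (Fin 3 → ℤ), (P = fcc3Int ∨ P = hcpInt) →
    ∀ a ∈ P, ∀ b ∈ P, ∀ c ∈ P, sqNormInt (a - b) = 18 → hexLabels a b ⊆ P → c ∉ hexLabels a b → c - a ∈ P → c - b ∈ P → sqNormInt (b - c) = 18 ∧ sqNormInt (a - c) = 18 ∧ sqNormInt (a - b - c) = 36 ∧ sqNormInt (b - a - c) = 36 ∧ sqNormInt (a - (c - b)) = 36 ∧ sqNormInt (b - (c - a)) = 36 ∧ sqNormInt (-a - (c - a)) = 18 ∧ sqNormInt (-b - (c - b)) = 18 ∧ sqNormInt (b - a - (c - a)) = 18 ∧ sqNormInt (a - b - (c - b)) = 18 ∧ sqNormInt (c - (c - a)) = 18 ∧ sqNormInt (c - (c - b)) = 18 ∧ sqNormInt (c - a - (c - b)) = 18 := by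
  rintro P (rfl | rfl) <;> decide

/-- A label `c` off the hexagon with `c + a, c + b` labels gives the odd cap `{c, c+a, c+b}`: a valid frame of parity `−1`. [folklore] -/
theorem isFrame_oddCap : ∀ P : Finset (Fin 3 → ℤ), (P = fcc3Int ∨ P = hcpInt) →
    ∀ a ∈ P, ∀ b ∈ P, ∀ c ∈ P, sqNormInt (a - b) = 18 → hexLabels a b ⊆ P → c ∉ hexLabels a b → c + a ∈ P → c + b ∈ P → IsFrame P a b ({c, c + a, c + b} : Finset (Fin 3 → ℤ)) ∧ frameParity a b ({c, c + a, c + b} : Finset (Fin 3 → ℤ)) = -1 := by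
  rintro P (rfl | rfl) <;> decide

/-- The odd cap is the cap of each of its elements. [folklore] -/
theorem capWithAny_oddCap : ∀ P : Finset (Fin 3 → ℤ), (P = fcc3Int ∨ P = hcpInt) →
    ∀ a ∈ P, ∀ b ∈ P, ∀ c ∈ P, ∀ m ∈ P, sqNormInt (a - b) = 18 → hexLabels a b ⊆ P → c ∉ hexLabels a b → c + a ∈ P → c + b ∈ P → m ∈ ({c, c + a, c + b} : Finset (Fin 3 → ℤ)) → capWithAny P a b {m} = ({c, c + a, c + b} : Finset (Fin 3 → ℤ)) := by
  rintro P (rfl | rfl) <;> decide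

end Summit.AtomisticToContinuum.Crystallization.Theorems.PalmUnimodularRigidityShellsToBarlowChart
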